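import Summits.Ventures.DiscreteObjects.PP12.OrderThirteenBase
import Summits.Ventures.DiscreteObjects.PP12.TriangleCase
import Summits.Ventures.DiscreteObjects.PP12.OrbitCountPrimeOrder

/-!
# PP(12), order-11 cell, Case B: the fixed structure is a triangle (kernel; FAMILY-B1P Lemma 4, Case B)
Framing: lottery ticket; floor = certified bounds/negative ranges.

Cell pub-namedobj (venture DiscreteObjects), target (M), designs gen 16. `PrimeOrderStructure.order12_q11_axis_or_two`: a collineation
`σ ≠ 1`, `σ¹¹ = 1` of a projective plane of order 12 is a homology (Case A, `OrderElevenHomology`) or EVERY FIXED LINE CARRIES EXACTLY TWO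
FIXED POINTS (Case B). This file finishes the paper step of Case B in the kernel: then there are EXACTLY THREE fixed points, they form a
TRIANGLE, and every fixed line is a side (`triangle_of_two_on_fixed_lines`, `fixed_line_through_two_of_three`): the count
`3` is `TriangleCase.fixedCard_points_eq_three_of_no_axis` (designs, earlier gen; no axis since an axis would carry 13 fixed points), and
non-collinearity is the hypothesis itself; `no_four_fixed` records the direct argument (four fixed points `a, b, c, d` would give fixed
lines `ab ≠ cd` meeting in a fifth fixed point on `ab`, which carries only `a, b`).
Also small shared tools for the order-11 files: for `τ^p = 1`, `p` prime, `p ∤ k`: `τ^k x = x → τ x = x`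
(`apply_eq_self_of_pow_apply_eq_self`), `τ ≠ 1 → τ^k ≠ 1` (`pow_ne_one_of_prime_not_dvd`); powers of a central collineation are central
with the same axis/centre (`power_isAxis`, `power_isCenter`); a fixed line contains the orbits of its points (`pow_apply_mem_of_fixed`);
`exists_mem_ne_ne`; and the two REGULARITY lemmas of the Case-B frame: a line through a fixed point `v` on two fixed lines, other than
those, is `σ^y m` for any base line `m ∋ v` moved by all `σ^k` (`pencil_regular11`); a point of a fixed line `a` other than two given
points `u, w` is `σ^x q` for a base point `q ∈ a` whose orbit avoids `u, w` (`side_regular11`) — both by "an injection `Fin 11 →` a set of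
`13 − 2` elements is onto". Proofs only (no definitions); nothing asserts any census statement. No `sorry`, no new axioms.
-/

namespace Summit.Ventures.DiscreteObjects.PP12

open Configuration Finset
open scoped Classical

section Perm

variable {α : Type*}

/-- `τ^p = 1`, `p` prime, `p ∤ k`: a point fixed by `τ^k` is fixed by `τ`. -/
theorem apply_eq_self_of_pow_apply_eq_self (τ : Equiv.Perm α) {p : ℕ} (hprime : p.Prime) (h : τ ^ p = 1) {k : ℕ} (hk : ¬ p ∣ k)
    {x : α} (hx : (τ ^ k) x = x) : τ x = x := by
  have hcop : Nat.Coprime k p := Nat.Coprime.symm ((Nat.Prime.coprime_iff_not_dvd hprime).2 hk)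
  obtain ⟨m, -, hm⟩ := Nat.exists_mul_mod_eq_one_of_coprime hcop hprime.one_lt
  have h1 : (τ ^ (k * m)) x = x := by rw [pow_mul]; exact Equiv.Perm.pow_apply_eq_self_of_apply_eq_self hx m
  rwa [pow_apply_eq_pow_mod τ h, hm, pow_one] at h1

/-- `τ^p = 1`, `τ ≠ 1`, `p` prime, `p ∤ k`: `τ^k ≠ 1`. -/
theorem pow_ne_one_of_prime_not_dvd (τ : Equiv.Perm α) {p : ℕ} (hprime : p.Prime) (h : τ ^ p = 1) (hne : τ ≠ 1) {k : ℕ}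
    (hk : ¬ p ∣ k) : τ ^ k ≠ 1 := by
  haveI : Fact p.Prime := ⟨hprime⟩
  have hord : orderOf τ = p := orderOf_eq_prime h hne
  intro h1
  exact hk (hord ▸ orderOf_dvd_of_pow_eq_one h1)

end Perm

section Frame

variable {P L : Type*} [Membership P L] [ProjectivePlane P L] [Fintype P] [Fintype L]

/-- On any line there is a point different from two given ones. -/
theorem exists_mem_ne_ne (m : L) (p q : P) : ∃ s : P, s ∈ m ∧ s ≠ p ∧ s ≠ q := by
  obtain ⟨a, b, c, ha, hb, hc, hab, hac, hbc⟩ := Collineation.exists_three_points (P := P) m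
  by_cases hap : a = p
  · subst hap
    by_cases hbq : b = q
    · subst hbq; exact ⟨c, hc, Ne.symm hac, Ne.symm hbc⟩
    · exact ⟨b, hb, Ne.symm hab, hbq⟩
  · by_cases haq : a = q
    · subst haq
      by_cases hbp : b = p
      · subst hbp; exact ⟨c, hc, Ne.symm hbc, Ne.symm hac⟩
      · exact ⟨b, hb, hbp, Ne.symm hab⟩
    · exact ⟨a, ha, hap, haq⟩

end Frame

namespace Collineation

variable {P L : Type*} [Membership P L] (σ : Collineation P L)

/-- Powers of a central collineation have the same axis … -/
theorem power_isAxis [ProjectivePlane P L] {l : L} (hl : σ.IsAxis l) (k : ℕ) : (σ.power k).IsAxis l := fun p hp =>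
  Equiv.Perm.pow_apply_eq_self_of_apply_eq_self (hl p hp) k

/-- … and the same centre. -/
theorem power_isCenter [ProjectivePlane P L] {c : P} (hc : σ.IsCenter c) (k : ℕ) : (σ.power k).IsCenter c := fun m hm =>
  Equiv.Perm.pow_apply_eq_self_of_apply_eq_self (hc m hm) k

/-- a fixed line through a point contains its whole orbit -/
theorem pow_apply_mem_of_fixed {m : L} (hm : σ.onLines m = m) {p : P} (hp : p ∈ m) (k : ℕ) : (σ.onPoints ^ k) p ∈ m := by
  have h := (σ.pow_mem_iff k p m).2 hp
  rwa [Equiv.Perm.pow_apply_eq_self_of_apply_eq_self hm k] at h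

/-- a fixed line contains the preimages of its points under powers -/
theorem pow_symm_apply_mem_of_fixed {m : L} (hm : σ.onLines m = m) {p : P} (hp : p ∈ m) (k : ℕ) : (σ.onPoints ^ k).symm p ∈ m := by
  rw [← σ.pow_mem_iff k, Equiv.apply_symm_apply, Equiv.Perm.pow_apply_eq_self_of_apply_eq_self hm k]; exact hp

variable [ProjectivePlane P L] [Fintype P] [Fintype L]

section ElevenB

variable (h12 : ProjectivePlane.order P L = 12) (hq : σ.onPoints ^ 11 = 1)
  (hB : ∀ l : L, σ.onLines l = l → ∀ [DecidablePred (· ∈ l)], σ.fixedOnLine l = 2)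

omit [Fintype L] in
include hB in
/-- **Case B: a fixed point on a fixed line through two fixed points `a ≠ b` is `a` or `b`.** -/
theorem fixed_on_line_eq_or_eq {m : L} {a b : P} (ha : a ∈ m) (hb : b ∈ m) (hab : a ≠ b) (fa : σ.onPoints a = a)
    (fb : σ.onPoints b = b) {p : P} (hp : p ∈ m) (fp : σ.onPoints p = p) : p = a ∨ p = b := by
  have hm : σ.onLines m = m := σ.line_fixed_of_two_fixed ha hb hab fa fb
  have h2 : (univ.filter fun x : P => x ∈ m ∧ σ.onPoints x = x).card = 2 := by
    have := hB m hm; unfold fixedOnLine at this; convert this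
  have hsub : ({a, b} : Finset P) ⊆ univ.filter fun x : P => x ∈ m ∧ σ.onPoints x = x := by
    intro x hx
    simp only [mem_insert, mem_singleton] at hx
    rcases hx with rfl | rfl
    · simp [ha, fa]
    · simp [hb, fb]
  have heq := Finset.eq_of_subset_of_card_le hsub (by rw [h2, card_pair hab])
  have hpF : p ∈ univ.filter fun x : P => x ∈ m ∧ σ.onPoints x = x := by simp [hp, fp]
  rw [← heq] at hpF
  simpa using hpF

omit [Fintype L] in
include hB in
/-- **Case B: no four fixed points.** -/
theorem no_four_fixed {a b c d : P} (fa : σ.onPoints a = a) (fb : σ.onPoints b = b) (fc : σ.onPoints c = c)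
    (fd : σ.onPoints d = d) (hab : a ≠ b) (hac : a ≠ c) (had : a ≠ d) (hbc : b ≠ c) (hbd : b ≠ d) (hcd : c ≠ d) : False := by
  have h1 := HasLines.mkLine_ax (L := L) hab
  have h2 := HasLines.mkLine_ax (L := L) hcd
  have hc1 : c ∉ (HasLines.mkLine hab : L) := fun hc => by
    rcases σ.fixed_on_line_eq_or_eq hB h1.1 h1.2 hab fa fb hc fc with h | h
    · exact hac h.symm
    · exact hbc h.symm
  have hne : (HasLines.mkLine hab : L) ≠ HasLines.mkLine hcd := fun h => hc1 (h ▸ h2.1)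
  have he := HasPoints.mkPoint_ax (P := P) hne
  have fab : σ.onLines (HasLines.mkLine hab : L) = HasLines.mkLine hab := σ.line_fixed_of_two_fixed h1.1 h1.2 hab fa fb
  have fcd : σ.onLines (HasLines.mkLine hcd : L) = HasLines.mkLine hcd := σ.line_fixed_of_two_fixed h2.1 h2.2 hcd fc fd
  have fe := σ.point_fixed_of_two_fixed he.1 he.2 hne fab fcd
  rcases σ.fixed_on_line_eq_or_eq hB h1.1 h1.2 hab fa fb he.1 fe with e1 | e1 <;>
    rcases σ.fixed_on_line_eq_or_eq hB h2.1 h2.2 hcd fc fd he.2 fe with e2 | e2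
  · exact hac (e1.symm.trans e2)
  · exact had (e1.symm.trans e2)
  · exact hbc (e1.symm.trans e2)
  · exact hbd (e1.symm.trans e2)

include h12 hq hB in
/-- **Case B: the fixed structure is a triangle.** Three pairwise distinct, non-collinear fixed points `a, b, c`, and every fixed
point is one of them. -/
theorem triangle_of_two_on_fixed_lines : ∃ a b c : P, σ.onPoints a = a ∧ σ.onPoints b = b ∧ σ.onPoints c = c ∧
    a ≠ b ∧ a ≠ c ∧ b ≠ c ∧ (∀ m : L, a ∈ m → b ∈ m → c ∉ m) ∧ ∀ p : P, σ.onPoints p = p → p = a ∨ p = b ∨ p = c := by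
  -- an axis would be a fixed line with 13 fixed points; `σ = 1` would make every line an axis
  have h13 : ∀ l : L, σ.IsAxis l → σ.fixedOnLine l = ProjectivePlane.order P L + 1 := fun l hl => by
    unfold fixedOnLine
    rw [← card_points_on_line (P := P) l]
    congr 1; ext p; simp only [mem_filter, mem_univ, true_and, and_iff_left_iff_imp]; exact hl p
  have hA : ∀ l : L, ¬ σ.IsAxis l := fun l hl => by
    have h2 := hB l (σ.axis_fixed hl); rw [h13 l hl, h12] at h2; exact absurd h2 (by norm_num)
  have hne : σ.onPoints ≠ 1 := fun h1 => by
    obtain ⟨l⟩ : Nonempty L := ⟨Classical.choice (by rw [← Fintype.card_pos_iff, ProjectivePlane.card_lines P L]; positivity)⟩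
    exact hA l fun p _ => by rw [h1]; rfl
  have h3 := σ.fixedCard_points_eq_three_of_no_axis h12 hne hq hA
  unfold fixedCard at h3
  obtain ⟨a, b, c, hab, hac, hbc, hS⟩ := Finset.card_eq_three.1 h3
  have hmem : ∀ p : P, σ.onPoints p = p ↔ p = a ∨ p = b ∨ p = c := fun p => by
    have : p ∈ (univ.filter fun x : P => σ.onPoints x = x) ↔ p ∈ ({a, b, c} : Finset P) := by rw [hS]
    simpa using this
  have fa := (hmem a).2 (Or.inl rfl)
  have fb := (hmem b).2 (Or.inr (Or.inl rfl))
  have fc := (hmem c).2 (Or.inr (Or.inr rfl))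
  refine ⟨a, b, c, fa, fb, fc, hab, hac, hbc, fun m ham hbm hcm => ?_, fun p => (hmem p).1⟩
  rcases σ.fixed_on_line_eq_or_eq hB ham hbm hab fa fb hcm fc with h | h
  · exact hac h.symm
  · exact hbc h.symm

omit [ProjectivePlane P L] [Fintype L] in
include hB in
/-- **Case B: a fixed line passes through two of the three fixed points.** -/
theorem fixed_line_through_two_of_three {a b c : P} (hall : ∀ p : P, σ.onPoints p = p → p = a ∨ p = b ∨ p = c) {m : L}
    (hm : σ.onLines m = m) : (a ∈ m ∧ b ∈ m) ∨ (b ∈ m ∧ c ∈ m) ∨ (a ∈ m ∧ c ∈ m) := by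
  have h2 : (univ.filter fun x : P => x ∈ m ∧ σ.onPoints x = x).card = 2 := by
    have := hB m hm; unfold fixedOnLine at this; convert this
  obtain ⟨x, y, hxy, hS⟩ := Finset.card_eq_two.1 h2
  have hx : x ∈ m ∧ σ.onPoints x = x := by
    have : x ∈ univ.filter fun z : P => z ∈ m ∧ σ.onPoints z = z := by rw [hS]; simp
    simpa using this
  have hy : y ∈ m ∧ σ.onPoints y = y := by
    have : y ∈ univ.filter fun z : P => z ∈ m ∧ σ.onPoints z = z := by rw [hS]; simp
    simpa using this
  rcases hall x hx.2 with rfl | rfl | rfl <;> rcases hall y hy.2 with rfl | rfl | rfl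
  all_goals first | exact absurd rfl hxy | tauto

/-! ### Regularity of a vertex pencil and of a side -/

include h12 in
/-- **Pencil regularity.** Let `v` be a point fixed by `σ` lying on two distinct fixed lines `a ≠ b`, and `m ∋ v` a line moved by every
`σ^k`, `11 ∤ k`. Then every line `ℓ ∋ v` other than `a, b` is `σ^y m` for some `y < 11`. -/
theorem pencil_regular11 {v : P} (fv : σ.onPoints v = v) {a b m : L} (hva : v ∈ a) (hvb : v ∈ b) (hab : a ≠ b)
    (fa : σ.onLines a = a) (fb : σ.onLines b = b) (hvm : v ∈ m) (hma : m ≠ a) (hmb : m ≠ b)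
    (hmov : ∀ k : ℕ, ¬ 11 ∣ k → (σ.onLines ^ k) m ≠ m) {ℓ : L} (hvℓ : v ∈ ℓ) (hℓa : ℓ ≠ a) (hℓb : ℓ ≠ b) :
    ∃ y : ℕ, y < 11 ∧ (σ.onLines ^ y) m = ℓ := by
  let T := {n : L // v ∈ n ∧ n ≠ a ∧ n ≠ b}
  have hT : Fintype.card T = 11 := by
    simp only [T]
    rw [Fintype.card_subtype]
    have h13 := card_lines_through (L := L) v
    rw [h12] at h13
    have hset : (univ.filter fun n : L => v ∈ n ∧ n ≠ a ∧ n ≠ b) = ((univ.filter fun n : L => v ∈ n).erase a).erase b := by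
      ext n; simp only [mem_filter, mem_univ, true_and, mem_erase]; tauto
    have hm1 : a ∈ univ.filter fun n : L => v ∈ n := by simp [hva]
    have hm2 : b ∈ (univ.filter fun n : L => v ∈ n).erase a := by rw [mem_erase]; exact ⟨Ne.symm hab, by simp [hvb]⟩
    rw [hset, card_erase_of_mem hm2, card_erase_of_mem hm1, h13]
  have hvk : ∀ k : ℕ, v ∈ (σ.onLines ^ k) m := fun k => by
    have h := (σ.pow_mem_iff k v m).2 hvm
    rwa [Equiv.Perm.pow_apply_eq_self_of_apply_eq_self fv k] at h
  have hnot : ∀ (k : ℕ) {c : L}, σ.onLines c = c → m ≠ c → (σ.onLines ^ k) m ≠ c := fun k c fc hmc h =>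
    hmc ((σ.onLines ^ k).injective (h.trans (Equiv.Perm.pow_apply_eq_self_of_apply_eq_self fc k).symm))
  let f : Fin 11 → T := fun y => ⟨(σ.onLines ^ (y : ℕ)) m, hvk y, hnot y fa hma, hnot y fb hmb⟩
  have hf : Function.Injective f := by
    intro x y hxy
    have e : (σ.onLines ^ (x : ℕ)) m = (σ.onLines ^ (y : ℕ)) m := congrArg Subtype.val hxy
    by_contra hne'
    have key : ∀ c d : ℕ, c < d → d < 11 → (σ.onLines ^ c) m = (σ.onLines ^ d) m → False := by
      intro c d hcd hd hfix
      have e' : (σ.onLines ^ c) m = (σ.onLines ^ c) ((σ.onLines ^ (d - c)) m) := by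
        rw [← Equiv.Perm.mul_apply, ← pow_add, show c + (d - c) = d by omega]; exact hfix
      exact hmov (d - c) (by omega) ((σ.onLines ^ c).injective e').symm
    rcases Nat.lt_or_gt_of_ne (fun h => hne' (Fin.ext h)) with hlt | hlt
    · exact key x y hlt y.isLt e
    · exact key y x hlt x.isLt e.symm
  have hbij : Function.Bijective f := (Fintype.bijective_iff_injective_and_card f).2 ⟨hf, by rw [Fintype.card_fin]; exact hT.symm⟩
  obtain ⟨y, hy⟩ := hbij.2 ⟨ℓ, hvℓ, hℓa, hℓb⟩
  exact ⟨y, y.isLt, congrArg Subtype.val hy⟩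

include h12 in
/-- **Side regularity.** Let `a` be a fixed line, `u ≠ w` two points of `a`, and `q ∈ a` a point moved by every `σ^k`, `11 ∤ k`, whose
orbit avoids `u, w`. Then every point `R ∈ a` other than `u, w` is `σ^x q` for some `x < 11`. -/
theorem side_regular11 {a : L} (fa : σ.onLines a = a) {u w q : P} (hu : u ∈ a) (hw : w ∈ a) (huw : u ≠ w) (hq' : q ∈ a)
    (hqu : ∀ k : ℕ, (σ.onPoints ^ k) q ≠ u) (hqw : ∀ k : ℕ, (σ.onPoints ^ k) q ≠ w) (hmov : ∀ k : ℕ, ¬ 11 ∣ k → (σ.onPoints ^ k) q ≠ q)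
    {R : P} (hR : R ∈ a) (hRu : R ≠ u) (hRw : R ≠ w) : ∃ x : ℕ, x < 11 ∧ (σ.onPoints ^ x) q = R := by
  let T := {p : P // p ∈ a ∧ p ≠ u ∧ p ≠ w}
  have hT : Fintype.card T = 11 := by
    simp only [T]
    rw [Fintype.card_subtype]
    have h13 := card_points_on_line (P := P) a
    rw [h12] at h13
    have hset : (univ.filter fun p : P => p ∈ a ∧ p ≠ u ∧ p ≠ w) = ((univ.filter fun p : P => p ∈ a).erase u).erase w := by
      ext p; simp only [mem_filter, mem_univ, true_and, mem_erase]; tauto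
    have hm1 : u ∈ univ.filter fun p : P => p ∈ a := by simp [hu]
    have hm2 : w ∈ (univ.filter fun p : P => p ∈ a).erase u := by rw [mem_erase]; exact ⟨Ne.symm huw, by simp [hw]⟩
    rw [hset, card_erase_of_mem hm2, card_erase_of_mem hm1, h13]
  let f : Fin 11 → T := fun x => ⟨(σ.onPoints ^ (x : ℕ)) q, σ.pow_apply_mem_of_fixed fa hq' x, hqu x, hqw x⟩
  have hf : Function.Injective f := by
    intro x y hxy
    have e : (σ.onPoints ^ (x : ℕ)) q = (σ.onPoints ^ (y : ℕ)) q := congrArg Subtype.val hxy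
    by_contra hne'
    have key : ∀ c d : ℕ, c < d → d < 11 → (σ.onPoints ^ c) q = (σ.onPoints ^ d) q → False := by
      intro c d hcd hd hfix
      have e' : (σ.onPoints ^ c) q = (σ.onPoints ^ c) ((σ.onPoints ^ (d - c)) q) := by
        rw [← Equiv.Perm.mul_apply, ← pow_add, show c + (d - c) = d by omega]; exact hfix
      exact hmov (d - c) (by omega) ((σ.onPoints ^ c).injective e').symm
    rcases Nat.lt_or_gt_of_ne (fun h => hne' (Fin.ext h)) with hlt | hlt
    · exact key x y hlt y.isLt e
    · exact key y x hlt x.isLt e.symm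
  have hbij : Function.Bijective f := (Fintype.bijective_iff_injective_and_card f).2 ⟨hf, by rw [Fintype.card_fin]; exact hT.symm⟩
  obtain ⟨x, hx⟩ := hbij.2 ⟨R, hR, hRu, hRw⟩
  exact ⟨x, x.isLt, congrArg Subtype.val hx⟩


end ElevenB

end Collineation

end Summit.Ventures.DiscreteObjects.PP12
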